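import Mathlib
import HarnessLib
import Literature.AlgebraicGeometry.Resolution.AffineBlowup
import Literature.AlgebraicGeometry.Resolution.BlowupPrincipalCharts
import Literature.AlgebraicGeometry.RelativeSpec.FiniteGroupQuotientGluing
import Summits.ResolutionOfSingularities.ResolutionOfSingularities.Theorems.WildQuotientsWildQuotientResolutionToricExitProjMap

/-!
# The seam: sections of a stable chart `D₊(s)` of `Bl_I(Spec R)` = the homogeneous localisation, equivariantly
(crux stmt-ResolutionOfSingularities-15640 `WildQuotients.WildQuotientResolution`, line `Sketch`;
chain w45c programmes V3U/V4U, res-L1-w45c-plan-1 RULING SEAM 2026-08-27T06:48:14Z (one shared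
adapter for the ring bricks H_a / H₀ / H₁ of RULING v7.5; statement = res-type-036's SIG (i)–(iv));
written by res-D-pv-033 AS res-L1-w45c-stub-5; [OURS · L1 W4.5c] — generic scheme/commutative-algebra
glue, NOT a statement of any manuscript.)

Setting: `V = Bl_I(Spec R) = Proj R[It]`, a finite group `G` acting on `R` with the affine-quotient
law `ρ g = Spec (g⁻¹ • ·)` and `I` stable (the p503738 binders `ρ, hρ, hJ`), an action
`ρB : ActionOver (π ≫ q) G` on `V` over an affine base whose automorphisms ARE the lifted action
(`haut`), a homogeneous `s = w tᵐ ∈ R[It]`, `0 < m`, with `G`-invariant coefficient `w`, the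
coefficientwise Rees automorphisms `φ g` (`ToricExit.exists_reesGradedHom_smul`; `φ g ↔ ρ♯ g`), and a
`G`-stable open `O` of `V` EQUAL to `D₊(s)`. Write `base : R → (R[It])_{(s)}`, `r ↦ r/1`.

* `BlowupExit.exists_pow_mul_eq_base` — every `y ∈ (R[It])_{(s)}` has `y · (w/1)ⁿ = r/1`;
  `BlowupExit.away_ringHom_ext` — ring maps out of `(R[It])_{(s)}` agreeing on `R` agree, once
  `w/1 ↦` a non-zero-divisor; `BlowupExit.map_away_eq_of_intertwines_deg` — the E-engine of
  p505671 in degree `m`;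
* `BlowupExit.appLE_π_eq_awayToSection` — `π^*(r)|_{D₊(s)} = awayToSection (r/1)`;
* **`BlowupExit.exists_basicOpen_sectionsEquiv`** — there is a ring isomorphism
  `Ω : (R[It])_{(s)} ≃ Γ(O, ⊤)` (precisely `Γ(↥O, (O.ι ≫ π ≫ q)⁻¹ ⊤)`, the sections object of
  `ActionOver.restrict`) with (i) `Ω (r/1) = (O.ι ≫ π)^*(r)` and (ii)
  `(ρB.restrict O).act g (Ω y) = Ω (HomogeneousLocalization.map (φ g⁻¹) y)`;
* **`BlowupExit.mem_invariantsRing_iff_of_sectionsEquiv`** — hence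
  `Ω y ∈ invariantsRing ⊤ ↔ ∀ g, HomogeneousLocalization.map (φ g) y = y`;
* `BlowupExit.restrict_act_ι_appLE` — the `ActionOver.restrict` bookkeeping (generic), isolated so
  that the kernel never unfolds `restrict` against a `Proj` scheme.
So each ring brick reduces to pure algebra in `(R[It])_{(s)}` (an injective `ψC : R₀ → (R[It])_{(s)}`
with range the common fixed points of the `map (φ g)`, and the radical identity on `base`-images),
the model transport being `map_away_eq_of_intertwines(_deg)`.
-/

-- single-problem summit: the doubled namespace component `ResolutionOfSingularities` is forced
set_option linter.dupNamespace false

noncomputable section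

open CategoryTheory AlgebraicGeometry TopologicalSpace Polynomial HomogeneousLocalization
open Literature.AlgebraicGeometry.Resolution Literature.AlgebraicGeometry.RelativeSpec
open scoped Pointwise

namespace Summit.ResolutionOfSingularities.ResolutionOfSingularities.Theorems.WildQuotientResolution.BlowupExit

universe u

variable {R : Type u} [CommRing R] {I : Ideal R}

/-! ## Algebra in `(R[It])_{(s)}` for a homogeneous `s = w tᵐ` -/

section Algebra

variable (s : reesAlgebra I) {m : ℕ} (hs : s ∈ reesGrading I m) (w : R) (hsw : (s : R[X]) = monomial m w)

include hsw in
/-- **`(x tⁿᵐ)/(s)ⁿ · (w/1)ⁿ = r/1`** for `x = r tⁿᵐ`, `s = w tᵐ`. [folklore] -/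
theorem awayMk_mul_base_pow (n : ℕ) (x : reesAlgebra I) (hx : x ∈ reesGrading I (n • m)) (r : R)
    (hxr : (x : R[X]) = monomial (n * m) r) :
    HomogeneousLocalization.Away.mk (reesGrading I) hs n x hx *
        ((fromZeroRingHom (reesGrading I) (.powers s)).comp (reesGrading.zeroRingHom I)) w ^ n =
      ((fromZeroRingHom (reesGrading I) (.powers s)).comp (reesGrading.zeroRingHom I)) r := by
  apply HomogeneousLocalization.val_injective
  rw [HomogeneousLocalization.val_mul, HomogeneousLocalization.val_pow,
    HomogeneousLocalization.Away.val_mk]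
  change _ * (Localization.mk (algebraMap R (reesAlgebra I) w)
      (1 : Submonoid.powers s)) ^ n =
    Localization.mk (algebraMap R (reesAlgebra I) r) (1 : Submonoid.powers s)
  rw [Localization.mk_pow, Localization.mk_mul, Localization.mk_eq_mk_iff, Localization.r_iff_exists]
  refine ⟨1, ?_⟩
  simp only [OneMemClass.coe_one, one_mul, one_pow, mul_one]
  apply Subtype.ext
  simp only [Subalgebra.coe_mul, Subalgebra.coe_pow, hxr, hsw, Subalgebra.coe_algebraMap,
    Polynomial.algebraMap_apply, ← C_mul_X_pow_eq_monomial, Algebra.algebraMap_self_apply]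
  ring

include hs hsw in
/-- **Every element of `(R[It])_{(s)}` becomes `r/1` after multiplication by a power of `w/1`.**
[folklore] -/
theorem exists_pow_mul_eq_base (y : HomogeneousLocalization.Away (reesGrading I) s) :
    ∃ (n : ℕ) (r : R),
      y * ((fromZeroRingHom (reesGrading I) (.powers s)).comp (reesGrading.zeroRingHom I)) w ^ n =
        ((fromZeroRingHom (reesGrading I) (.powers s)).comp (reesGrading.zeroRingHom I)) r := by
  obtain ⟨n, x, hx, rfl⟩ := HomogeneousLocalization.Away.mk_surjective (reesGrading I) hs y
  obtain ⟨r, hr⟩ := (mem_reesGrading_iff I).mp (by simpa [smul_eq_mul] using hx)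
  exact ⟨n, r, awayMk_mul_base_pow s hs w hsw n x hx r hr.symm⟩

include hs hsw in
/-- **Ring maps out of `(R[It])_{(s)}` are determined by their values on `R`** once `w/1` is sent to a
non-zero-divisor. [folklore] -/
theorem away_ringHom_ext {S : Type*} [CommRing S]
    (f₁ f₂ : HomogeneousLocalization.Away (reesGrading I) s →+* S)
    (hb : ∀ r : R, f₁ (((fromZeroRingHom (reesGrading I) (.powers s)).comp
      (reesGrading.zeroRingHom I)) r) =
      f₂ (((fromZeroRingHom (reesGrading I) (.powers s)).comp (reesGrading.zeroRingHom I)) r))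
    (hnzd : f₁ (((fromZeroRingHom (reesGrading I) (.powers s)).comp (reesGrading.zeroRingHom I)) w) ∈
      nonZeroDivisors S) :
    f₁ = f₂ := by
  refine RingHom.ext fun y => ?_
  obtain ⟨n, r, key⟩ := exists_pow_mul_eq_base s hs w hsw y
  have hbn := pow_mem hnzd n
  rw [← mul_cancel_right_mem_nonZeroDivisors hbn]
  have h1 : f₁ y * f₁ (((fromZeroRingHom (reesGrading I) (.powers s)).comp
      (reesGrading.zeroRingHom I)) w) ^ n =
      f₁ (((fromZeroRingHom (reesGrading I) (.powers s)).comp (reesGrading.zeroRingHom I)) r) := by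
    rw [← map_pow, ← map_mul, key]
  have h2 : f₂ y * f₂ (((fromZeroRingHom (reesGrading I) (.powers s)).comp
      (reesGrading.zeroRingHom I)) w) ^ n =
      f₂ (((fromZeroRingHom (reesGrading I) (.powers s)).comp (reesGrading.zeroRingHom I)) r) := by
    rw [← map_pow, ← map_mul, key]
  rw [h1, hb r, ← h2, ← hb w]

variable (φ : reesGrading I →+*ᵍ reesGrading I) (τ : R →+* R)
  (hφ : ∀ x : reesAlgebra I, ((φ x : reesAlgebra I) : R[X]) = (x : R[X]).map τ)
  (hτw : τ w = w)

include hφ hsw hτw in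
/-- `φ` fixes `s = w tᵐ` when `τ w = w`. [folklore] -/
theorem reesGradedHom_eq_self_of_monomial : φ s = s := by
  apply Subtype.ext
  rw [hφ, hsw, Polynomial.map_monomial, hτw]

include hφ hsw hτw in
/-- The powers of `s` are mapped into themselves by `φ`. [folklore] -/
theorem powers_le_comap_of_monomial : Submonoid.powers s ≤ (Submonoid.powers s).comap φ := by
  rintro _ ⟨n, rfl⟩
  refine ⟨n, ?_⟩
  change s ^ n = φ (s ^ n)
  rw [map_pow, reesGradedHom_eq_self_of_monomial s w hsw φ τ hφ hτw]

include hφ in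
/-- **`ψ(r/1) = τ(r)/1`** for `ψ = HomogeneousLocalization.map φ` on `(R[It])_{(s)}`. [folklore] -/
theorem map_base (hP : Submonoid.powers s ≤ (Submonoid.powers s).comap φ) (r : R) :
    HomogeneousLocalization.map φ hP
        (((fromZeroRingHom (reesGrading I) (.powers s)).comp (reesGrading.zeroRingHom I)) r) =
      ((fromZeroRingHom (reesGrading I) (.powers s)).comp (reesGrading.zeroRingHom I)) (τ r) := by
  apply HomogeneousLocalization.val_injective
  change (HomogeneousLocalization.map φ hP (HomogeneousLocalization.mk _)).val =
    (HomogeneousLocalization.mk _).val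
  rw [HomogeneousLocalization.map_mk, HomogeneousLocalization.val_mk, HomogeneousLocalization.val_mk]
  dsimp only
  congr 1
  · change (φ ((reesGrading.zeroRingHom I r : reesGrading I 0) : reesAlgebra I) : reesAlgebra I) =
      ((reesGrading.zeroRingHom I (τ r) : reesGrading I 0) : reesAlgebra I)
    rw [reesGrading.coe_zeroRingHom, reesGrading.coe_zeroRingHom,
      ToricExit.reesGradedHom_algebraMap φ τ hφ]
  · exact Subtype.ext (map_one φ)

include hφ hs hsw hτw in
/-- **The E-engine in degree `m`**: for a model `e : (R[It])_{(s)} → S` with `e(w/1)` a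
non-zero-divisor and `Σ : S → S` intertwining `τ` on `R`, `e ∘ HomogeneousLocalization.map φ = Σ ∘ e`
(p505671 `ToricExit.map_away_eq_of_intertwines` is the case `m = 1`). [folklore] -/
theorem map_away_eq_of_intertwines_deg
    (hP : Submonoid.powers s ≤ (Submonoid.powers s).comap φ)
    {S : Type*} [CommRing S] (e : HomogeneousLocalization.Away (reesGrading I) s →+* S)
    (hnzd : e (((fromZeroRingHom (reesGrading I) (.powers s)).comp (reesGrading.zeroRingHom I)) w) ∈
      nonZeroDivisors S) (Sg : S →+* S)
    (hSg : ∀ r : R, Sg (e (((fromZeroRingHom (reesGrading I) (.powers s)).comp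
      (reesGrading.zeroRingHom I)) r)) =
      e (((fromZeroRingHom (reesGrading I) (.powers s)).comp (reesGrading.zeroRingHom I)) (τ r)))
    (y : HomogeneousLocalization.Away (reesGrading I) s) :
    e (HomogeneousLocalization.map φ hP y) = Sg (e y) := by
  obtain ⟨n, r, key⟩ := exists_pow_mul_eq_base s hs w hsw y
  have hbn := pow_mem hnzd n
  rw [← mul_cancel_right_mem_nonZeroDivisors hbn]
  have h0 : HomogeneousLocalization.map φ hP
      (((fromZeroRingHom (reesGrading I) (.powers s)).comp (reesGrading.zeroRingHom I)) w) =
      ((fromZeroRingHom (reesGrading I) (.powers s)).comp (reesGrading.zeroRingHom I)) w := by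
    rw [map_base s φ τ hφ hP, hτw]
  have h1 : e (HomogeneousLocalization.map φ hP y) *
        e (((fromZeroRingHom (reesGrading I) (.powers s)).comp (reesGrading.zeroRingHom I)) w) ^ n =
      e (((fromZeroRingHom (reesGrading I) (.powers s)).comp (reesGrading.zeroRingHom I)) (τ r)) := by
    rw [← h0, ← map_pow, ← map_pow, ← map_mul, ← map_mul, key, map_base s φ τ hφ hP r]
  have h3 : Sg (e (((fromZeroRingHom (reesGrading I) (.powers s)).comp
      (reesGrading.zeroRingHom I)) w)) =
      e (((fromZeroRingHom (reesGrading I) (.powers s)).comp (reesGrading.zeroRingHom I)) w) := by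
    rw [hSg, hτw]
  have h2 : Sg (e y) *
        e (((fromZeroRingHom (reesGrading I) (.powers s)).comp (reesGrading.zeroRingHom I)) w) ^ n =
      e (((fromZeroRingHom (reesGrading I) (.powers s)).comp (reesGrading.zeroRingHom I)) (τ r)) := by
    rw [← h3, ← map_pow, ← map_mul, ← map_pow, ← map_mul, key, hSg]
  rw [h1, h2]

end Algebra

/-! ## Sections over `D₊(s)`: `π^*(r)|_{D₊(s)} = awayToSection (r/1)` -/

section Sections

variable (s : reesAlgebra I) {m : ℕ} (hs : s ∈ reesGrading I m) (hm : 0 < m)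

include hs hm in
/-- `D₊(s) ↪ Bl → Spec R` is `Spec` of `base : R → (R[It])_{(s)}` after the chart identification
`D₊(s) ≅ Spec (R[It])_{(s)}` (`Proj.awayι_toSpecZero`). [folklore] -/
theorem basicOpen_ι_comp_π :
    (Proj.basicOpen (reesGrading I) s).ι ≫ affineBlowup.π I =
      Proj.basicOpenToSpec (reesGrading I) s ≫ Spec.map (CommRingCat.ofHom
        ((fromZeroRingHom (reesGrading I) (.powers s)).comp (reesGrading.zeroRingHom I))) := by
  rw [← Proj.basicOpenIsoSpec_hom _ s hs hm, ← Iso.inv_comp_eq, Proj.basicOpenIsoSpec_inv_ι_assoc,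
    affineBlowup.π, Proj.awayι_toSpecZero_assoc, ← Spec.map_comp]
  rfl

include hs hm in
/-- **`π^*(r)|_{D₊(s)} = awayToSection (r/1)`**: the pull-back of `r ∈ R` to the sections of
`Bl_I(Spec R)` over `D₊(s)` is the image of `r/1 ∈ (R[It])_{(s)}` under Mathlib's
`Proj.awayToSection`. [folklore] -/
theorem appLE_π_eq_awayToSection
    (h : Proj.basicOpen (reesGrading I) s ≤ affineBlowup.π I ⁻¹ᵁ ⊤) (r : R) :
    (affineBlowup.π I).appLE ⊤ (Proj.basicOpen (reesGrading I) s) h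
        ((Scheme.ΓSpecIso (CommRingCat.of R)).inv r) =
      Proj.awayToSection (reesGrading I) s
        (((fromZeroRingHom (reesGrading I) (.powers s)).comp (reesGrading.zeroRingHom I)) r) := by
  let D := Proj.basicOpen (reesGrading I) s
  -- global sections of `D ↪ Bl → Spec R`
  have h1 : (D.ι ≫ affineBlowup.π I).appTop ((Scheme.ΓSpecIso (CommRingCat.of R)).inv r) =
      D.topIso.inv (Proj.awayToSection (reesGrading I) s
        (((fromZeroRingHom (reesGrading I) (.powers s)).comp (reesGrading.zeroRingHom I)) r)) := by
    rw [basicOpen_ι_comp_π s hs hm, Scheme.Hom.comp_appTop, CommRingCat.comp_apply]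
    have hnat := Scheme.ΓSpecIso_inv_naturality (CommRingCat.ofHom
      ((fromZeroRingHom (reesGrading I) (.powers s)).comp (reesGrading.zeroRingHom I)))
    have h2 : (Spec.map (CommRingCat.ofHom ((fromZeroRingHom (reesGrading I) (.powers s)).comp
        (reesGrading.zeroRingHom I)))).appTop ((Scheme.ΓSpecIso (CommRingCat.of R)).inv r) =
        (Scheme.ΓSpecIso (CommRingCat.of (HomogeneousLocalization.Away (reesGrading I) s))).inv
          (((fromZeroRingHom (reesGrading I) (.powers s)).comp (reesGrading.zeroRingHom I)) r) := by
      have := congrArg (fun k : CommRingCat.of R ⟶ _ => k.hom r) hnat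
      simp only [CommRingCat.hom_comp, RingHom.coe_comp, Function.comp_apply,
        CommRingCat.hom_ofHom] at this
      exact this.symm
    rw [h2]
    change ((Proj.basicOpenToSpec (reesGrading I) s).app ⊤) _ = _
    rw [Proj.basicOpenToSpec_app_top, ← CommRingCat.comp_apply (Scheme.ΓSpecIso _).inv]
    erw [Iso.inv_hom_id_assoc]
    rfl
  -- compare with `π.appLE ⊤ D ≫ D.topIso.inv`
  have h3 : (affineBlowup.π I).appLE ⊤ D h ≫ D.ι.appLE D ⊤ (fun x _ => x.2) =
      (D.ι ≫ affineBlowup.π I).appTop := by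
    rw [Scheme.Hom.appLE_comp_appLE, Scheme.Hom.appTop, Scheme.Hom.app_eq_appLE]
    rfl
  have h4 := congrArg (fun k => k ((Scheme.ΓSpecIso (CommRingCat.of R)).inv r)) h3
  simp only [CommRingCat.comp_apply] at h4
  rw [ι_appLE_eq_topIso_inv, h1] at h4
  exact (ConcreteCategory.injective_of_mono_of_preservesPullback D.topIso.inv) h4

end Sections

/-! ## The seam: `Γ(D₊(s), 𝒪) ≃ (R[It])_{(s)}` equivariantly, and the invariants -/

section Seam

/-- **The restricted action through the inclusion**: for a `G`-stable open `O ⊆ X` and a section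
`z ∈ Γ(X, O)`, the action of `g` on `z|_O ∈ Γ(O, ⊤)` for `ActionOver.restrict` is the pull-back of
`z` along `ρ(g⁻¹)`, restricted to `O`. (Generic; isolates the `restrict` bookkeeping.) [folklore] -/
theorem restrict_act_ι_appLE {X Y : Scheme.{u}} {r : X ⟶ Y} {G : Type*} [Group G]
    (ρ : ActionOver r G) (O : X.Opens) (hO : ∀ g : G, (ρ.aut g).hom ⁻¹ᵁ O = O) (g : G)
    (hle : (O.ι ≫ r) ⁻¹ᵁ ⊤ ≤ O.ι ⁻¹ᵁ O) (z : Γ(X, O)) :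
    (ρ.restrict O hO).act g ⊤ (O.ι.appLE O ((O.ι ≫ r) ⁻¹ᵁ ⊤) hle z) =
      O.ι.appLE O ((O.ι ≫ r) ⁻¹ᵁ ⊤) hle ((ρ.aut g⁻¹).hom.appLE O O (hO g⁻¹).ge z) := by
  rw [ActionOver.act_apply, ActionOver.restrict_aut_hom, ← CommRingCat.comp_apply,
    ← CommRingCat.comp_apply]
  congr 1
  rw [Scheme.Hom.appLE_comp_appLE, appLE_congr_hom (ρ.restrictHom_ι O hO g⁻¹),
    Scheme.Hom.appLE_comp_appLE]

variable {G : Type*} [Group G] [MulSemiringAction G R]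

/-- **The family `φ g` of coefficientwise Rees automorphisms** (`φ g` acts by `g⁻¹` on
coefficients, so that `ρ♯ g = Proj.map (φ g)`), for a pointwise `G`-stable ideal. [folklore] -/
theorem exists_reesGradedHom_family (hGI : ∀ g : G, g • I = I) :
    ∃ φ : G → (reesGrading I →+*ᵍ reesGrading I),
      (∀ (g : G) (x : reesAlgebra I), ((φ g x : reesAlgebra I) : R[X]) =
        (x : R[X]).map ((MulSemiringAction.toRingEquiv G R g⁻¹ : R ≃+* R) : R →+* R)) ∧
      ∀ g : G, HomogeneousIdeal.irrelevant (reesGrading I) ≤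
        (HomogeneousIdeal.irrelevant (reesGrading I)).map (φ g) := by
  have hGI' : ∀ g : G, I.map ((MulSemiringAction.toRingEquiv G R g : R ≃+* R) : R →+* R) = I :=
    fun g => ToricExit.map_toRingEquiv_eq_of_smul_eq hGI g
  choose φ hφ hf using fun g : G => ToricExit.exists_reesGradedHom_smul (I := I) hGI' g
  exact ⟨φ, hφ, hf⟩

variable (ρ : G →* Aut (Spec (CommRingCat.of R)))
  (hρ : ∀ g : G, (ρ g).hom = Spec.map (CommRingCat.ofHom
    ((MulSemiringAction.toRingEquiv G R g⁻¹ : R ≃+* R) : R →+* R)))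
  (hJ : ∀ g : G, (affineBlowup.idealSheaf I).comap (ρ g).hom = affineBlowup.idealSheaf I)
  {Y : Scheme.{u}} (q : Spec (CommRingCat.of R) ⟶ Y)
  (ρB : ActionOver (affineBlowup.π I ≫ q) G)
  (haut : ∀ g : G, (ρB.aut g).hom = ((affineBlowup.isBlowup I).liftAction ρ hJ g).hom)
  (s : reesAlgebra I) {m : ℕ} (hs : s ∈ reesGrading I m) (hm : 0 < m)
  (φ : G → (reesGrading I →+*ᵍ reesGrading I))
  (hφ : ∀ (g : G) (x : reesAlgebra I), ((φ g x : reesAlgebra I) : R[X]) =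
    (x : R[X]).map ((MulSemiringAction.toRingEquiv G R g⁻¹ : R ≃+* R) : R →+* R))
  (hf : ∀ g : G, HomogeneousIdeal.irrelevant (reesGrading I) ≤
    (HomogeneousIdeal.irrelevant (reesGrading I)).map (φ g))
  (hφs : ∀ g : G, φ g s = s)
  (hP : ∀ g : G, Submonoid.powers s ≤ (Submonoid.powers s).comap (φ g))
  (O : (affineBlowup I).Opens) (hO : ∀ g : G, (ρB.aut g).hom ⁻¹ᵁ O = O)
  (hOs : O = Proj.basicOpen (reesGrading I) s)

include hρ haut hs hm hφ hf hφs hOs in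
/-- **THE SEAM.** For a `G`-stable open `O = D₊(s)` of `Bl_I(Spec R)` (`s = w tᵐ`, `0 < m`), the
sections `Γ(↥O, ⊤)` on which `ActionOver.restrict` acts are the homogeneous localisation
`(R[It])_{(s)}`: there is a ring isomorphism `Ω` with (i) `Ω(r/1) = (O ↪ Bl → Spec R)^*(r)` and
(ii) `(ρB|_O).act g (Ω y) = Ω (HomogeneousLocalization.map (φ g⁻¹) y)` — the action `act g`
pulls back along `ρ♯ g⁻¹ = Proj.map (φ g⁻¹)` (…ToricExitProjMap `awayToSection_comp_appLE_liftAction`).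
[folklore] -/
theorem exists_basicOpen_sectionsEquiv :
    ∃ Ω : HomogeneousLocalization.Away (reesGrading I) s ≃+*
        Γ((O : Scheme.{u}), (O.ι ≫ affineBlowup.π I ≫ q) ⁻¹ᵁ ⊤),
      (∀ r : R, Ω (((fromZeroRingHom (reesGrading I) (.powers s)).comp (reesGrading.zeroRingHom I)) r) =
        (O.ι ≫ affineBlowup.π I).appLE ⊤ ((O.ι ≫ affineBlowup.π I ≫ q) ⁻¹ᵁ ⊤) le_top
          ((Scheme.ΓSpecIso (CommRingCat.of R)).inv r)) ∧
      ∀ (g : G) (y : HomogeneousLocalization.Away (reesGrading I) s),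
        (ρB.restrict O hO).act g ⊤ (Ω y) =
          Ω (HomogeneousLocalization.map (φ g⁻¹) (hP g⁻¹) y) := by
  subst hOs
  -- the isomorphism `θ : (R[It])_{(s)} → Γ(Bl, D₊(s)) → Γ(↥D₊(s), ⊤)`
  haveI : IsIso (Proj.awayToSection (reesGrading I) s) := by
    rw [← Proj.basicOpenIsoAway_hom _ s hs hm]; infer_instance
  have hle : (((Proj.basicOpen (reesGrading I) s).ι ≫ affineBlowup.π I ≫ q) ⁻¹ᵁ ⊤) ≤
      (Proj.basicOpen (reesGrading I) s).ι ⁻¹ᵁ Proj.basicOpen (reesGrading I) s := fun x _ => x.2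
  have hθ : (Proj.basicOpen (reesGrading I) s).ι.appLE (Proj.basicOpen (reesGrading I) s)
      (((Proj.basicOpen (reesGrading I) s).ι ≫ affineBlowup.π I ≫ q) ⁻¹ᵁ ⊤) hle =
      (Proj.basicOpen (reesGrading I) s).topIso.inv :=
    ι_appLE_eq_topIso_inv _ _
  let θ : CommRingCat.of (HomogeneousLocalization.Away (reesGrading I) s) ⟶
      Γ(((Proj.basicOpen (reesGrading I) s : (affineBlowup I).Opens) : Scheme.{u}),
        ((Proj.basicOpen (reesGrading I) s).ι ≫ affineBlowup.π I ≫ q) ⁻¹ᵁ ⊤) :=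
    Proj.awayToSection (reesGrading I) s ≫ (Proj.basicOpen (reesGrading I) s).topIso.inv
  haveI : IsIso θ := IsIso.comp_isIso
  have hθapp : ∀ y, (asIso θ).commRingCatIsoToRingEquiv y =
      (Proj.basicOpen (reesGrading I) s).ι.appLE (Proj.basicOpen (reesGrading I) s)
        (((Proj.basicOpen (reesGrading I) s).ι ≫ affineBlowup.π I ≫ q) ⁻¹ᵁ ⊤) hle
        (Proj.awayToSection (reesGrading I) s y) := by
    intro y
    rw [hθ]
    rfl
  refine ⟨(asIso θ).commRingCatIsoToRingEquiv, fun r => ?_, fun g y => ?_⟩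
  · -- (i)
    rw [hθapp, ← appLE_π_eq_awayToSection s hs hm le_top r, ← CommRingCat.comp_apply,
      Scheme.Hom.appLE_comp_appLE]
  · -- (ii)
    have hst : Proj.basicOpen (reesGrading I) s ≤
        (ρB.aut g⁻¹).hom ⁻¹ᵁ Proj.basicOpen (reesGrading I) s := (hO g⁻¹).ge
    have k2 : Proj.awayToSection (reesGrading I) s ≫
        (ρB.aut g⁻¹).hom.appLE (Proj.basicOpen (reesGrading I) s) (Proj.basicOpen (reesGrading I) s)
          hst =
        CommRingCat.ofHom (HomogeneousLocalization.map (φ g⁻¹) (hP g⁻¹)) ≫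
          Proj.awayToSection (reesGrading I) s := by
      rw [appLE_congr_hom (haut g⁻¹)]
      exact ToricExit.awayToSection_comp_appLE_liftAction ρ hρ hJ g⁻¹ (φ g⁻¹) (hφ g⁻¹) (hf g⁻¹)
        s s (hφs g⁻¹) hs (hP g⁻¹) _
    rw [hθapp, hθapp, restrict_act_ι_appLE ρB (Proj.basicOpen (reesGrading I) s) hO g hle]
    congr 1
    rw [← CommRingCat.comp_apply, k2, CommRingCat.comp_apply]
    rfl

omit [MulSemiringAction G R] in
/-- **Invariants through the seam.** If `Ω` satisfies (ii) of `exists_basicOpen_sectionsEquiv`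
then `Ω y` is a `G`-invariant section iff `y` is fixed by every `HomogeneousLocalization.map (φ g)`.
[folklore] -/
theorem mem_invariantsRing_iff_of_sectionsEquiv
    (Ω : HomogeneousLocalization.Away (reesGrading I) s ≃+* Γ((O : Scheme.{u}), (O.ι ≫ affineBlowup.π I ≫ q) ⁻¹ᵁ ⊤))
    (hΩ : ∀ (g : G) (y : HomogeneousLocalization.Away (reesGrading I) s),
      (ρB.restrict O hO).act g ⊤ (Ω y) = Ω (HomogeneousLocalization.map (φ g⁻¹) (hP g⁻¹) y))
    (y : HomogeneousLocalization.Away (reesGrading I) s) :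
    Ω y ∈ (ρB.restrict O hO).invariantsRing ⊤ ↔
      ∀ g : G, HomogeneousLocalization.map (φ g) (hP g) y = y := by
  rw [ActionOver.mem_invariantsRing_iff]
  constructor
  · intro h g
    have h' := h g⁻¹
    rw [hΩ, inv_inv] at h'
    exact Ω.injective h'
  · intro h g
    rw [hΩ, h g⁻¹]

end Seam

end Summit.ResolutionOfSingularities.ResolutionOfSingularities.Theorems.WildQuotientResolution.BlowupExit

end
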